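import Literature.Analysis.SegalBargmann.SchwartzHeisenbergDerivative
import Literature.Analysis.SegalBargmann.HermiteLadderRigidity
import Literature.Analysis.SegalBargmann.SchwartzHeisenbergModel
import Literature.Analysis.SegalBargmann.SchwartzCarrierTransport
import HarnessLib

/-!
# Schur's lemma for the Schrödinger representation on Schwartz space, and uniqueness of continuous implementers

Source of the objects: G. B. Folland, *Harmonic Analysis in Phase Space* (1989) §1.3 (1.25) (tree `rhoS`), and of the
language: C. Moeglin, M.-F. Vignéras, J.-L. Waldspurger, *Correspondances de Howe sur un corps p-adique* (1987)
Chap. 2, II.1–II.2 (`MpPsi`, "M est unique à un scalaire près", tree `SchwartzHeisenbergModel`).  Print proves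
irreducibility of the UNITARY representation `ρ` on `L²` (Folland Prop. (1.43), via the Fourier–Wigner transform); the statement below is its
Schwartz-space form for merely CONTINUOUS operators, which is what a continuous (non-unitary) metaplectic-type
implementer needs.  Everything is PROVED (tree + Mathlib); nothing of print is asserted or used as a hypothesis.

## Main results (`SR σ = 𝓢(ℝ^σ, ℂ)` on the sup-norm carrier, every finite `σ`)

* §1 **`eq_smul_of_commute_rhoS`**: a continuous linear `T : 𝓢(ℝ^σ) → 𝓢(ℝ^σ)` with `T ρ(p,q) = ρ(p,q) T` for all
  `p, q` satisfies `T f = schurCoeff T • f` (`schurCoeff T` = the vacuum Hermite coefficient of `T h₀`).  Proof: `T`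
  commutes with the multipliers `x_j` (`comm_mulDot_of_comm_rhoS`, derivative of the modulation group in the Schwartz
  topology) and with `∂_j` (`comm_lineDerivOp_of_comm_rhoS`, Fourier conjugation), hence is a scalar by the Hermite
  ladder rigidity `eq_smul_of_commute_coord_lineDeriv` (file `HermiteLadderRigidity`).
* §2 **`implements_eq_smul_of_continuous`**: two implementers `M, M'` of the same symplectic `g` on `𝓢(ℝ^σ)`
  (`Implements (schwartzSchrodinger σ) (ofSymplectic g)`, equivalently `(g, M) ∈ MpPsi`) with `M⁻¹` and `M'` continuous
  differ by a scalar `c ≠ 0`; `…_of_continuousLinearEquiv`, `eq_smul_of_mem_MpPsi_of_continuous`.  (With unitary `L²`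
  lifts one gets `‖c‖ = 1`: tree `implements_eq_unitSmul_of_liftsTo`.)
* §3 **`eq_smul_of_commute_rhoSD`**: the same Schur lemma on any transported carrier `𝓢(D)`, `D ≃L[ℝ] ℝ^σ`
  (`rhoSD`, `schwartzTransport`).

## References

* [Folland1989] G. B. Folland, *Harmonic Analysis in Phase Space*, Annals of Mathematics Studies 122, Princeton UP,
  1989, §1.3 (1.25), §1.4 Prop. (1.42)–(1.43) (doi:10.1515/9781400882427).
* [MoeglinVignerasWaldspurger1987] C. Moeglin, M.-F. Vignéras, J.-L. Waldspurger, *Correspondances de Howe sur un corps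
  p-adique*, LNM 1291, Springer, 1987, Chap. 2, II.1–II.2 (doi:10.1007/BFb0082712).
-/

noncomputable section

open MeasureTheory Complex Real Filter Topology
open LineDeriv

namespace Literature.Analysis.SegalBargmann

open Literature.RepresentationTheory.HeisenbergGroup

local notation "SR" σ:max => (SchwartzMap (σ → ℝ) ℂ)
local notation "SE" σ:max => (SchwartzMap (EuclideanSpace ℝ σ) ℂ)
local notation "SD" D:max => (SchwartzMap D ℂ)
local notation "L2R" σ:max => (Lp ℂ 2 (volume : Measure (σ → ℝ)))

variable {σ : Type*} [Fintype σ] [DecidableEq σ]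
variable {D : Type*} [NormedAddCommGroup D] [NormedSpace ℝ D]

/-! ## 1. Schur's lemma for `ρ` on `𝓢(ℝ^σ)` -/

/-- `mulDot` at a coordinate vector is the coordinate multiplier `x ↦ x_j`. [folklore] -/
theorem mulDot_single (j : σ) (f : SR σ) :
    mulDot (Pi.single j 1) f = SchwartzMap.smulLeftCLM ℂ (fun x : σ → ℝ => ((x j : ℝ) : ℂ)) f := by
  ext x
  rw [mulDot_apply, SchwartzMap.smulLeftCLM_apply_apply (hasTemperateGrowth_coordPi j), dotProduct_single,
    mul_one, smul_eq_mul]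

/-- **The Schur coefficient** of an operator on `𝓢(ℝ^σ)`: the vacuum Hermite coefficient of `T h₀`. [folklore] -/
def schurCoeff (T : (SR σ) →L[ℂ] SR σ) : ℂ :=
  hermiteCoeff 0 ((schwartzTransport (euclE σ)).symm (T (hermitePi 0)))

/-- **Schur's lemma for the Schrödinger representation on Schwartz space.** A continuous linear operator
`T : 𝓢(ℝ^σ) → 𝓢(ℝ^σ)` commuting with every Heisenberg operator `ρ(p,q)` is the scalar `schurCoeff T`.
[folklore] -/
theorem eq_smul_of_commute_rhoS (T : (SR σ) →L[ℂ] SR σ)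
    (hT : ∀ (p q : σ → ℝ) (f : SR σ), T (rhoS p q f) = rhoS p q (T f)) (f : SR σ) :
    T f = schurCoeff T • f :=
  eq_smul_of_commute_coord_lineDeriv T
    (fun j g => by rw [← mulDot_single, ← mulDot_single]; exact comm_mulDot_of_comm_rhoS T hT _ g)
    (fun j g => comm_lineDerivOp_of_comm_rhoS T hT _ g) f

/-- Operator form: `T = schurCoeff T • id`. [folklore] -/
theorem eq_smul_id_of_commute_rhoS (T : (SR σ) →L[ℂ] SR σ)
    (hT : ∀ (p q : σ → ℝ) (f : SR σ), T (rhoS p q f) = rhoS p q (T f)) :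
    T = schurCoeff T • ContinuousLinearMap.id ℂ (SR σ) :=
  ContinuousLinearMap.ext fun f => by
    rw [eq_smul_of_commute_rhoS T hT f]; rfl

/-! ## 2. Continuous implementers of a symplectic map are unique up to a nonzero scalar -/

/-- The Hermite functions on the Folland carrier are nonzero. [folklore] -/
theorem hermitePi_ne_zero (α : σ →₀ ℕ) : (hermitePi α : SR σ) ≠ 0 := fun h => by
  have h1 := (orthonormal_hermiteL2 (σ := σ)).ne_zero α
  rw [← toL2_hermitePi, h, map_zero] at h1
  exact h1 rfl

/-- **"M est unique à un scalaire près", continuous form.** Two implementers `M, M'` of the same symplectic map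
`g` on `𝓢(ℝ^σ)` with `M⁻¹` and `M'` continuous in the Schwartz topology differ by a nonzero scalar:
`M' = c • M`. [folklore] -/
theorem implements_eq_smul_of_continuous {g : symplecticGroup (polar (dotPairing σ))}
    {M M' : (SR σ) ≃ₗ[ℂ] SR σ}
    (hM : Implements (schwartzSchrodinger σ) (ofSymplectic _ g) M)
    (hM' : Implements (schwartzSchrodinger σ) (ofSymplectic _ g) M')
    (hMs : Continuous M.symm) (hM'c : Continuous M') :
    ∃ c : ℂ, c ≠ 0 ∧ ∀ f : SR σ, M' f = c • M f := by
  rw [implements_ofSymplectic_iff] at hM hM'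
  let T : (SR σ) →L[ℂ] SR σ := ⟨(M' : (SR σ) →ₗ[ℂ] SR σ) ∘ₗ (M.symm : (SR σ) →ₗ[ℂ] SR σ), hM'c.comp hMs⟩
  have hTapp : ∀ f, T f = M' (M.symm f) := fun f => rfl
  have hsymm : ∀ (p q : σ → ℝ) (f : SR σ),
      M.symm (rhoS (g.1 (p, q)).1 (g.1 (p, q)).2 f) = rhoS p q (M.symm f) := by
    intro p q f
    apply M.injective
    rw [hM, LinearEquiv.apply_symm_apply, LinearEquiv.apply_symm_apply]
  have hT : ∀ (p q : σ → ℝ) (f : SR σ), T (rhoS p q f) = rhoS p q (T f) := by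
    intro p q f
    obtain ⟨p', q', hpq⟩ : ∃ p' q', g.1 (p', q') = (p, q) :=
      ⟨(g.1.symm (p, q)).1, (g.1.symm (p, q)).2, by rw [Prod.mk.eta, LinearEquiv.apply_symm_apply]⟩
    have h1 : p = (g.1 (p', q')).1 := by rw [hpq]
    have h2 : q = (g.1 (p', q')).2 := by rw [hpq]
    rw [hTapp, hTapp, h1, h2, hsymm, hM']
  have hS := eq_smul_of_commute_rhoS T hT
  refine ⟨schurCoeff T, fun hc => ?_, fun f => ?_⟩
  · have h1 := hS (M (hermitePi 0))
    rw [hc, zero_smul, hTapp, LinearEquiv.symm_apply_apply] at h1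
    exact hermitePi_ne_zero 0 (M'.injective (h1.trans (map_zero M').symm))
  · rw [← hS (M f), hTapp, LinearEquiv.symm_apply_apply]

/-- The same for continuous linear equivalences. [folklore] -/
theorem implements_eq_smul_of_continuousLinearEquiv {g : symplecticGroup (polar (dotPairing σ))}
    {M M' : (SR σ) ≃L[ℂ] SR σ}
    (hM : Implements (schwartzSchrodinger σ) (ofSymplectic _ g) (M : (SR σ) ≃ₗ[ℂ] SR σ))
    (hM' : Implements (schwartzSchrodinger σ) (ofSymplectic _ g) (M' : (SR σ) ≃ₗ[ℂ] SR σ)) :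
    ∃ c : ℂ, c ≠ 0 ∧ ∀ f : SR σ, M' f = c • M f :=
  implements_eq_smul_of_continuous hM hM' M.symm.continuous M'.continuous

/-- `MpPsi` form: two elements of the intertwining group `MpPsi` over the same `g` with continuous operators
differ by a nonzero scalar. [folklore] -/
theorem eq_smul_of_mem_MpPsi_of_continuous {g : symplecticGroup (polar (dotPairing σ))}
    {M M' : (SR σ) ≃ₗ[ℂ] SR σ}
    (hM : (g, M) ∈ MpPsi (schwartzSchrodinger σ)) (hM' : (g, M') ∈ MpPsi (schwartzSchrodinger σ))
    (hMs : Continuous M.symm) (hM'c : Continuous M') :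
    ∃ c : ℂ, c ≠ 0 ∧ ∀ f : SR σ, M' f = c • M f :=
  implements_eq_smul_of_continuous ((implements_ofSymplectic_iff σ g M).2 ((mem_MpPsi_iff σ g M).1 hM))
    ((implements_ofSymplectic_iff σ g M').2 ((mem_MpPsi_iff σ g M').1 hM')) hMs hM'c

/-! ## 3. Transport to any carrier `𝓢(D)`, `D ≃ ℝ^σ` -/

/-- **Schur's lemma on a transported carrier**: a continuous `T : 𝓢(D) → 𝓢(D)` commuting with every transported
Heisenberg operator `rhoSD e p q` is a scalar. [folklore] -/
theorem eq_smul_of_commute_rhoSD (e : D ≃L[ℝ] (σ → ℝ)) (T : (SD D) →L[ℂ] SD D)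
    (hT : ∀ (p q : σ → ℝ) (f : SD D), T (rhoSD e p q f) = rhoSD e p q (T f)) :
    ∃ c : ℂ, ∀ f : SD D, T f = c • f := by
  let T' : (SR σ) →L[ℂ] SR σ :=
    ((schwartzTransport e : (SD D) →L[ℂ] SR σ).comp T).comp ((schwartzTransport e).symm : (SR σ) →L[ℂ] SD D)
  have hT'app : ∀ f, T' f = schwartzTransport e (T ((schwartzTransport e).symm f)) := fun f => rfl
  have hT' : ∀ (p q : σ → ℝ) (f : SR σ), T' (rhoS p q f) = rhoS p q (T' f) := by
    intro p q f
    rw [hT'app, hT'app, schwartzTransport_symm_rhoS, hT, schwartzTransport_rhoSD]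
  refine ⟨schurCoeff T', fun f => ?_⟩
  have h1 := eq_smul_of_commute_rhoS T' hT' (schwartzTransport e f)
  rw [hT'app, ContinuousLinearEquiv.symm_apply_apply] at h1
  have h2 := congrArg (schwartzTransport e).symm h1
  rwa [ContinuousLinearEquiv.symm_apply_apply, map_smul, ContinuousLinearEquiv.symm_apply_apply] at h2

end Literature.Analysis.SegalBargmann
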